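import Literature.NumberTheory.Sieve.LevelOfDistributionProofs
import Literature.NumberTheory.Sieve.PolymathGEHPiecesPrimes
import Literature.NumberTheory.Sieve.ElliottHalberstamBridgeProofs
import HarnessLib

/-!
# Prime pieces in progressions from a level of distribution in `π`-form (Theorem 3.6(ii), `r = 1`)

Trunk AntSieve, tooling toward the named fact `Literature.NumberTheory.Sieve.weakDHL_three_two_of_GEH`
(D. H. J. Polymath, Res. Math. Sci. 1:12 (2014) = arXiv:1407.4897, Theorem 3.2(xii)).  In the `Σ₃`
step of §4.5 (p. 17) the tuples with a single prime (`r = 1`, `A_{j_1}` = primes in one range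
`⊂ [x + h_k, 2x + h_k]`) are not bilinear, so Claim 2.6 does not apply to them; their discrepancies
are controlled directly by `EH` (available from `GEH` by Proposition 2.7) in its `π`-form
`PrimesHaveLevelPi` (`LevelOfDistribution.lean`; `PrimesHaveLevel.primesHaveLevelPi`).  This file
records that step: for `1 ≤ m ≤ m' ≤ x`, `q ≥ 1`,
`|Δ(1_{primes in (m,m']}; a (q))| ≤ |π-disc(m')| + |π-disc(m)| + ω(q)/φ(q)`
(`abs_apDiscrepancy_primePiece_le`), and hence, from `PrimesHaveLevelPi θ'` with `θ < θ'`,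
`Σ_{q ≤ x^θ} sup_a |Δ(1_{primes in (m,m']}; N; a (q))| ≤ C x (log x)^{-A}` uniformly in
`1 ≤ m ≤ m' ≤ x`, `N ≥ m'` (`sum_iSup_apDiscrepancy_primePiece_le`).

## References

* [Polymath8b2014] D. H. J. Polymath, Res. Math. Sci. 1 (2014), Art. 12 = arXiv:1407.4897,
  §4.5, p. 17.
-/

noncomputable section

open Finset Real Filter Asymptotics
open scoped ArithmeticFunction.omega

namespace Literature.NumberTheory.Sieve

/-! ### The discrepancy of a prime piece through `π(N; q, a) − π(N)/φ(q)` -/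

/-- The first sum of the discrepancy of the prime piece and the tree's `primeCountingDisc`:
`Σ_{m<n≤m', n≡a} 1_P(n) − (π(m') − π(m))/φ(q) = primeCountingDisc q a m' − primeCountingDisc q a m`
(the range-`(N+1)` sums of `primeCountingDisc` telescope). [folklore] -/
theorem primeCountingDisc_sub (q : ℕ) (a : ZMod q) {m m' : ℕ} (hmm' : m ≤ m') :
    primeCountingDisc q a m' - primeCountingDisc q a m =
      ∑ n ∈ Ioc m m', (if n.Prime then apIndicator q a n - 1 / (Nat.totient q : ℝ) else 0) := by
  unfold primeCountingDisc
  rw [Finset.range_eq_Ico, Finset.range_eq_Ico,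
    ← Finset.sum_Ico_consecutive _ (Nat.zero_le (m + 1)) (by omega : m + 1 ≤ m' + 1)]
  have : Finset.Ico (m + 1) (m' + 1) = Ioc m m' := by
    ext n; simp only [Finset.mem_Ico, Finset.mem_Ioc]; omega
  rw [this]; ring

/-- `ω(q) ≤ 2 log q` for `q ≥ 1`. [folklore] -/
private theorem omega_le_two_log {q : ℕ} (hq : q ≠ 0) : (ω q : ℝ) ≤ 2 * Real.log q := by
  have h1 : 2 ^ ω q ≤ q := by
    rw [ArithmeticFunction.cardDistinctFactors_apply, ← List.card_toFinset, Nat.toFinset_factors]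
    calc 2 ^ q.primeFactors.card = ∏ _p ∈ q.primeFactors, 2 := by rw [Finset.prod_const]
      _ ≤ ∏ p ∈ q.primeFactors, p := Finset.prod_le_prod' fun p hp => (Nat.prime_of_mem_primeFactors hp).two_le
      _ ≤ q := Nat.le_of_dvd (Nat.pos_of_ne_zero hq) (Nat.prod_primeFactors_dvd q)
  have h2 : (ω q : ℝ) * Real.log 2 ≤ Real.log q := by
    rw [← Real.log_pow]; exact Real.log_le_log (by positivity) (by exact_mod_cast h1)
  have h3 := Real.log_two_gt_d9
  have h4 : 0 ≤ (ω q : ℝ) := Nat.cast_nonneg _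
  nlinarith

/-- **The prime piece through the `π`-discrepancies**: for `q ≥ 1`, `m ≤ m' ≤ N`,
`|Δ(1_{primes in (m,m']}; N; a (q))| ≤ |primeCountingDisc q a m'| + |primeCountingDisc q a m| + ω(q)/φ(q)`
(the coprime mean misses only the primes dividing `q`). [folklore] -/
theorem abs_apDiscrepancy_primePiece_le {q : ℕ} (hq : 1 ≤ q) (a : (ZMod q)ˣ) {m m' N : ℕ}
    (hmm' : m ≤ m') (hN : m' ≤ N) :
    |apDiscrepancy (fun n => (primePiece m m' n : ℝ)) N q a| ≤
      |primeCountingDisc q a m'| + |primeCountingDisc q a m| + (ω q : ℝ) / Nat.totient q := by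
  have hq0 : q ≠ 0 := by omega
  have hφ0 : (0 : ℝ) < Nat.totient q := by exact_mod_cast Nat.totient_pos.2 (by omega)
  -- restrict both sums of `Δ` to `(m, m']`
  have hres : ∀ (p : ℕ → Prop) [DecidablePred p],
      ∑ n ∈ (Icc 1 N).filter p, (primePiece m m' n : ℝ) =
        ∑ n ∈ (Ioc m m').filter p, (if n.Prime then (1 : ℝ) else 0) := by
    intro p _
    have hsub : (Ioc m m').filter p ⊆ (Icc 1 N).filter p := by
      refine Finset.filter_subset_filter p fun n hn => ?_
      rw [Finset.mem_Ioc] at hn; rw [Finset.mem_Icc]; omega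
    rw [← Finset.sum_subset hsub]
    · refine Finset.sum_congr rfl fun n hn => ?_
      have hn' := (Finset.mem_filter.1 hn).1
      rw [Finset.mem_Ioc] at hn'
      rw [primePiece_apply]
      by_cases hp : n.Prime
      · rw [if_pos ⟨hn'.1, hn'.2, hp⟩, if_pos hp]
      · rw [if_neg (fun h => hp h.2.2), if_neg hp]
    · intro n hn hn'
      have hp : p n := (Finset.mem_filter.1 hn).2
      have hnot : n ∉ Ioc m m' := fun h => hn' (Finset.mem_filter.2 ⟨h, hp⟩)
      rw [Finset.mem_Ioc] at hnot
      rw [primePiece_apply, if_neg]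
      exact fun h => hnot ⟨h.1, h.2.1⟩
  unfold apDiscrepancy
  rw [hres, hres]
  -- `S₁ − (π-count)/φ = PCD m' − PCD m`
  set S₁ := ∑ n ∈ (Ioc m m').filter (fun n : ℕ => (n : ZMod q) = a), (if n.Prime then (1 : ℝ) else 0) with hS₁
  set S₂ := ∑ n ∈ (Ioc m m').filter (fun n : ℕ => n.Coprime q), (if n.Prime then (1 : ℝ) else 0) with hS₂
  set Pc := ∑ n ∈ Ioc m m', (if n.Prime then (1 : ℝ) else 0) with hPc
  have hPCD : primeCountingDisc q a m' - primeCountingDisc q a m = S₁ - Pc / Nat.totient q := by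
    rw [primeCountingDisc_sub q a hmm', hS₁, hPc, Finset.sum_filter, Finset.sum_div, ← Finset.sum_sub_distrib]
    refine Finset.sum_congr rfl fun n _ => ?_
    unfold apIndicator
    by_cases hp : n.Prime <;> by_cases ha : (n : ZMod q) = a <;> simp [hp, ha]
  -- `0 ≤ Pc − S₂ ≤ ω(q)`: the primes in `(m, m']` dividing `q`
  have hdiff : Pc - S₂ = ∑ n ∈ (Ioc m m').filter (fun n : ℕ => ¬ n.Coprime q), (if n.Prime then (1 : ℝ) else 0) := by
    rw [hPc, hS₂, ← Finset.sum_filter_add_sum_filter_not (Ioc m m') (fun n : ℕ => n.Coprime q)]; ring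
  have hd0 : 0 ≤ Pc - S₂ := by
    rw [hdiff]; exact Finset.sum_nonneg fun n _ => by split_ifs <;> norm_num
  have hd1 : Pc - S₂ ≤ (ω q : ℝ) := by
    rw [hdiff, ← Finset.sum_filter]
    -- the primes `p ∈ (m, m']` with `(p, q) > 1` divide `q`
    have hsub : ((Ioc m m').filter (fun n : ℕ => ¬ n.Coprime q)).filter Nat.Prime ⊆ q.primeFactors := by
      intro p hp
      simp only [Finset.mem_filter] at hp
      rw [Nat.mem_primeFactors]
      refine ⟨hp.2, ?_, hq0⟩
      exact (Nat.Prime.dvd_iff_not_coprime hp.2).2 hp.1.2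
    calc ∑ n ∈ ((Ioc m m').filter (fun n : ℕ => ¬ n.Coprime q)).filter Nat.Prime, (1 : ℝ)
        ≤ ∑ _p ∈ q.primeFactors, (1 : ℝ) := Finset.sum_le_sum_of_subset_of_nonneg hsub fun _ _ _ => zero_le_one
      _ = (ω q : ℝ) := by
          rw [Finset.sum_const, nsmul_eq_mul, mul_one, ArithmeticFunction.cardDistinctFactors_apply,
            ← List.card_toFinset, Nat.toFinset_factors]
  -- assemble: `S₁ − S₂/φ = (PCD m' − PCD m) + (Pc − S₂)/φ`
  have e : S₁ - S₂ / Nat.totient q = (primeCountingDisc q a m' - primeCountingDisc q a m) + (Pc - S₂) / Nat.totient q := by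
    rw [hPCD]; ring
  rw [e]
  have h3 : |(Pc - S₂) / Nat.totient q| ≤ (ω q : ℝ) / Nat.totient q := by
    rw [abs_div, abs_of_pos hφ0, abs_of_nonneg hd0]
    exact div_le_div_of_nonneg_right hd1 hφ0.le
  have := abs_add_le (primeCountingDisc q a m' - primeCountingDisc q a m) ((Pc - S₂) / Nat.totient q)
  have := abs_sub (primeCountingDisc q a m') (primeCountingDisc q a m)
  linarith

/-! ### Summing over the moduli with `PrimesHaveLevelPi` -/

/-- **Prime pieces in progressions from a level of distribution** (`r = 1` case of the `Σ₃` step):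
if `PrimesHaveLevelPi θ'` and `θ < θ'`, then for every `A > 0` there is `C` with, eventually in `x`,
for all `1 ≤ m ≤ m' ≤ x` and `N ≥ m'`,
`Σ_{q ≤ x^θ} sup_a |Δ(1_{primes in (m,m']}; N; a (q))| ≤ C x (log x)^{-A}`. [cite: Polymath8b2014, §4.5, p. 17] -/
theorem sum_iSup_apDiscrepancy_primePiece_le {θ θ' : ℝ} (hθ : θ < θ') (hθ1 : θ < 1)
    (hpi : PrimesHaveLevelPi θ') {A : ℝ} (hA : 0 < A) :
    ∃ C : ℝ, ∀ᶠ x : ℝ in atTop, ∀ m m' N : ℕ, 1 ≤ m → m ≤ m' → (m' : ℝ) ≤ x → m' ≤ N →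
      ∑ q ∈ Icc 1 ⌊x ^ θ⌋₊, (⨆ a : (ZMod q)ˣ, |apDiscrepancy (fun n => (primePiece m m' n : ℝ)) N q a|) ≤
        C * x / Real.log x ^ A := by
  -- the level statement with `ε = θ' − θ`
  obtain ⟨Cπ, hCπ⟩ := (hpi A hA (θ' - θ) (by linarith)).bound
  have hθθ : θ' - (θ' - θ) = θ := by ring
  refine ⟨2 * max Cπ 0 + 1, ?_⟩
  -- eventually `2 x^θ log x ≤ x / log^A x`
  have e1 : ∀ᶠ x : ℝ in atTop, 2 * (x ^ θ * (2 * Real.log x)) ≤ x / Real.log x ^ A := by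
    by_cases hθ0 : θ ≤ 0
    · -- `x^θ ≤ 1`
      have := (isLittleO_log_rpow_rpow_atTop (A + 1) (by norm_num : (0:ℝ) < 1)).bound (show (0:ℝ) < 1 / 4 by norm_num)
      filter_upwards [this, eventually_ge_atTop (Real.exp 1)] with x hx hx1
      have hx0 : 0 < x := lt_of_lt_of_le (Real.exp_pos 1) hx1
      have hL : 1 ≤ Real.log x := by rwa [Real.le_log_iff_exp_le hx0]
      have hL0 : 0 < Real.log x := by linarith
      rw [Real.norm_of_nonneg (Real.rpow_nonneg hL0.le _), Real.norm_of_nonneg (Real.rpow_nonneg hx0.le _),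
        Real.rpow_one] at hx
      have hxge1 : (1 : ℝ) ≤ x := le_trans (by have := Real.add_one_le_exp (1:ℝ); linarith) hx1
      have hxθ : x ^ θ ≤ 1 := Real.rpow_le_one_of_one_le_of_nonpos hxge1 hθ0
      rw [le_div_iff₀ (Real.rpow_pos_of_pos hL0 A)]
      have hA1 : Real.log x ^ (A + 1) = Real.log x ^ A * Real.log x := by
        rw [Real.rpow_add hL0, Real.rpow_one]
      have hLA : 0 ≤ Real.log x ^ A := Real.rpow_nonneg hL0.le A
      calc 2 * (x ^ θ * (2 * Real.log x)) * Real.log x ^ A ≤ 2 * (1 * (2 * Real.log x)) * Real.log x ^ A := by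
            gcongr
        _ = 4 * Real.log x ^ (A + 1) := by rw [hA1]; ring
        _ ≤ x := by linarith
    · rw [not_le] at hθ0
      have := (isLittleO_log_rpow_rpow_atTop (A + 1) (by linarith : 0 < 1 - θ)).bound (show (0:ℝ) < 1 / 4 by norm_num)
      filter_upwards [this, eventually_ge_atTop (Real.exp 1)] with x hx hx1
      have hx0 : 0 < x := lt_of_lt_of_le (Real.exp_pos 1) hx1
      have hL : 1 ≤ Real.log x := by rwa [Real.le_log_iff_exp_le hx0]
      have hL0 : 0 < Real.log x := by linarith
      rw [Real.norm_of_nonneg (Real.rpow_nonneg hL0.le _), Real.norm_of_nonneg (Real.rpow_nonneg hx0.le _)] at hx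
      rw [le_div_iff₀ (Real.rpow_pos_of_pos hL0 A)]
      have hA1 : Real.log x ^ (A + 1) = Real.log x ^ A * Real.log x := by
        rw [Real.rpow_add hL0, Real.rpow_one]
      have hsplit : x = x ^ θ * x ^ (1 - θ) := by
        rw [← Real.rpow_add hx0]; ring_nf; exact (Real.rpow_one x).symm
      calc 2 * (x ^ θ * (2 * Real.log x)) * Real.log x ^ A = x ^ θ * (4 * Real.log x ^ (A + 1)) := by rw [hA1]; ring
        _ ≤ x ^ θ * x ^ (1 - θ) := mul_le_mul_of_nonneg_left (by linarith) (Real.rpow_nonneg hx0.le _)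
        _ = x := hsplit.symm
  filter_upwards [hCπ, e1, eventually_ge_atTop (1 : ℝ)] with x hxπ hx1' hx1 m m' N hm hmm' hm'x hN
  have hx0 : 0 < x := by linarith
  rw [hθθ] at hxπ
  set Q := ⌊x ^ θ⌋₊ with hQ
  -- the level bound
  set Eπ : ℕ → ℝ := fun q => ⨆ y : Set.Icc 1 x, ⨆ a : (ZMod q)ˣ,
      |(LevelOfDistribution.primeCountingMod q (a : ZMod q).val ⌊(y : ℝ)⌋₊ : ℝ) -
        (Nat.primeCounting ⌊(y : ℝ)⌋₊ : ℝ) / Nat.totient q| with hEπ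
  have hsumπ : ∑ q ∈ Icc 1 Q, Eπ q ≤ max Cπ 0 * (x / Real.log x ^ A) := by
    have hnn : 0 ≤ ∑ q ∈ Icc 1 Q, Eπ q := Finset.sum_nonneg fun q _ =>
      Real.iSup_nonneg fun _ => Real.iSup_nonneg fun _ => abs_nonneg _
    have hxA : 0 ≤ x / Real.log x ^ A := div_nonneg hx0.le (Real.rpow_nonneg (Real.log_nonneg hx1) A)
    rw [Real.norm_of_nonneg hnn, Real.norm_of_nonneg hxA] at hxπ
    exact hxπ.trans (mul_le_mul_of_nonneg_right (le_max_left _ _) hxA)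
  -- pointwise in `q`
  have hmx : (m : ℝ) ≤ x := le_trans (by exact_mod_cast hmm') hm'x
  have step : ∀ q ∈ Icc 1 Q, (⨆ a : (ZMod q)ˣ, |apDiscrepancy (fun n => (primePiece m m' n : ℝ)) N q a|) ≤
      2 * Eπ q + 2 * Real.log x := by
    intro q hq
    rw [Finset.mem_Icc] at hq
    have hq0 : q ≠ 0 := by omega
    haveI : NeZero q := ⟨hq0⟩
    haveI : Nonempty (ZMod q)ˣ := ⟨1⟩
    have hφ1 : (1 : ℝ) ≤ Nat.totient q := by exact_mod_cast Nat.totient_pos.2 (by omega)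
    have hqx : (q : ℝ) ≤ x := by
      have h1 : (q : ℝ) ≤ Q := by exact_mod_cast hq.2
      have h2 : (Q : ℝ) ≤ x ^ θ := Nat.floor_le (Real.rpow_nonneg hx0.le _)
      have h3 : x ^ θ ≤ x := by
        calc x ^ θ ≤ x ^ (1 : ℝ) := Real.rpow_le_rpow_of_exponent_le hx1 hθ1.le
          _ = x := Real.rpow_one x
      linarith
    have hω : (ω q : ℝ) / Nat.totient q ≤ 2 * Real.log x := by
      refine (div_le_self (Nat.cast_nonneg _) hφ1).trans ((omega_le_two_log hq0).trans ?_)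
      exact mul_le_mul_of_nonneg_left (Real.log_le_log (by exact_mod_cast Nat.pos_of_ne_zero hq0) hqx) (by norm_num)
    refine ciSup_le fun a => (abs_apDiscrepancy_primePiece_le hq.1 a hmm' hN).trans ?_
    have h1 := abs_primeCountingDisc_le_iSup hq0 a (x := x) (by omega : 1 ≤ m') hm'x
    have h2 := abs_primeCountingDisc_le_iSup hq0 a (x := x) hm hmx
    change |primeCountingDisc q a m'| ≤ Eπ q at h1
    change |primeCountingDisc q a m| ≤ Eπ q at h2
    linarith
  refine (Finset.sum_le_sum step).trans ?_
  rw [Finset.sum_add_distrib, ← Finset.mul_sum, Finset.sum_const, Nat.card_Icc, add_tsub_cancel_right,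
    nsmul_eq_mul]
  have hQx : (Q : ℝ) ≤ x ^ θ := Nat.floor_le (Real.rpow_nonneg hx0.le _)
  have hlog0 : 0 ≤ Real.log x := Real.log_nonneg hx1
  have hQterm : (Q : ℝ) * (2 * Real.log x) ≤ x ^ θ * (2 * Real.log x) :=
    mul_le_mul_of_nonneg_right hQx (by linarith)
  have hnnA : 0 ≤ x ^ θ * (2 * Real.log x) := mul_nonneg (Real.rpow_nonneg hx0.le _) (by linarith)
  have e : (2 * max Cπ 0 + 1) * x / Real.log x ^ A = 2 * (max Cπ 0 * (x / Real.log x ^ A)) + x / Real.log x ^ A := by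
    ring
  rw [e]
  linarith [hsumπ, hx1']

end Literature.NumberTheory.Sieve
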